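import Summits.QuantumFields.BalabanUV.Beta.D1BFx.TorusJetSandwichArrays
import Summits.QuantumFields.BalabanUV.Beta.D1BFx.TorusGhostWordArrays
import Summits.QuantumFields.BalabanUV.Beta.D1BFx.TorusWeightJetsCombFree
import Summits.QuantumFields.BalabanUV.Beta.D1BFx.KGhostLegJunction

/-!
# TB4-W PART 3b-N (FILE N1) — bond-fibred arrays: tools for the N-side weight words (road «BF-x», slot (K); K-END-RECUT-SPEC v1 §2)

Owner spec `HOME/b2b-balaban-beta-d1-p2/K-END-RECUT-SPEC.md` §2 (journal l.25308): the GLUON family of the re-cut END is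
`𝒱N = Π̂ᵀ𝒱_MΠ̂ + ℬ`, the STRAIGHT weight jets `ℬ = gram₁(Tjet, Ajet)`-words `= 2•wgt₁`, `2•wgtMix` of «TB4-W» 3a
(`TorusWeightJetsCombFree`) «as `ℤ⁴` arrays (3b-N)».  Those words are BOND × BOND matrices `(Mjet•)ᵀ·Ĉ·(Mjet•)` with the
composite ghost leg `Ĉ` INSIDE; this file supplies the bond-fibred (`F = Fin 4`) array calculus and the torus letters that turn
them into periodised arrays of fixed `ℤ⁴` kernels (the assembly of `2•wgt₁` is the sequel `TorusWeightWordArrays`).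

CONTENT (`s = (m+1)·p`, `D̂ := Dhat 4 s`, `L̂ := Lhat s`, `Ĉ := Chat s N` of 3a, `perT` of 3b-gh B1):
* §1 array linearity for a general fibre in matrix form: `(arr (V + W))^ = (arr V)^ + (arr W)^`, `(arr (−V))^ = −(arr V)^`,
  `(arr (c•V))^ = c•(arr V)^`, `(arr (V − W))^ = …` (the `ℤ⁴`-level linearity is 3b-gh B1∕B2's `arr_add`∕`arr_sub`∕`arr_neg` at `F = Unit`; here inlined).
* §2 **`dSw ∘ arr = arr ∘ dSw`** (the bond sandwich `d∘·∘dᵀ` of `RJetAssembly` commutes with the array) and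
  **`D̂ · perT (arr Z) · D̂ᵀ = (arr (dSw Z))^`** (3b-β FILE 2's `Dhat_mul_Yhat_mul_Dhat_transpose` at `Y := arr Z`).
* §3 the legs: common rate `dB n a := min 1 (deltaCgh n a)`; `L̂ = perT lapU` (B1), `Ĉ = perT (Cgh (m+1) a)` is the owner's
  `KGhostLegJunction.Chat_eq_submatrix_periodiseF_Cgh` (`perT` unfolded; imported, not restated),
  **`1 − P̂ = perT (Rgt (m+1) a)`**, **`L̂·Ĉ = perT (lapU ∘ Cgh)`**, **`Ĉ·L̂ = perT (Cgh ∘ lapU)`** (`KGhostLeg.periodiseF_toF_comp`), decay and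
  joint `s`-periodicity of `lapU ∘ Cgh`, `Cgh ∘ lapU` (the `hA`∕`hAper` letters of B1's product rules).

[folklore] array calculus; the one [our object] def `dB` is an explicit rate; nothing is asserted.
-/

noncomputable section

namespace Summit.QuantumFields.BalabanUV.Beta.D1BFx.TorusBondArrays

open Matrix
open scoped BigOperators
open Literature.MathematicalPhysics.QuantumFieldTheory.Balaban1983to89
open Literature.MathematicalPhysics.QuantumFieldTheory.Balaban1983to89.Beta
open B12Sec2to5 (l1 l1_nonneg)
open ExpKernelCalculus (MKer BiLoc Decays Zl comp shiftK comp_shiftK)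
open AffineAveraging (unitVec)
open BalabanStepJetsSucc (decays_comp)
open Summit.QuantumFields.BalabanUV.Beta.TameKernelCalculus (decays_of_le)
open Summit.QuantumFields.BalabanUV.Beta.D1BFx.PeriodicArrays (arr arr_apply toF toF_apply Kfib_toF isPeriodic₂_arr rowBound_arr summable_arr_term
  imageShift_eq_add_smul periodic_of_shiftK)
open Summit.QuantumFields.BalabanUV.Beta.D1BFx.FibredPeriodisation (Kfib Kfib_apply periodiseF periodiseF_apply periodiseF_add)
open Summit.QuantumFields.BalabanUV.Beta.D1BFx.GhostLeg (Ggh)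
open Summit.QuantumFields.BalabanUV.Beta.D1BFx.RJetProjector (Rgt)
open Summit.QuantumFields.BalabanUV.Beta.D1BFx.RJetAssembly (dSw dSw_apply)
open Summit.QuantumFields.BalabanUV.Beta.D1BFx.PeriodisedKernels (isPeriodic₂_lapKer)
open Summit.QuantumFields.BalabanUV.Beta.D1BFx.PeriodisedProjector (Lhat Phat Shat)
open Summit.QuantumFields.BalabanUV.Beta.D1BFx.TorusHodgeWeight (Dhat)
open Summit.QuantumFields.BalabanUV.Beta.D1BFx.TorusWeightJetsCombFree (Chat Lhat_Chat_Lhat)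
open Summit.QuantumFields.BalabanUV.Beta.D1BFx.TorusJetSandwichArrays (Dhat_mul_Yhat_mul_Dhat_transpose)
open Summit.QuantumFields.BalabanUV.Beta.D1BFx.TorusGhostWordArrays (perT perT_apply_tsum submatrix_unit_mul lapU lapU_apply decays_lapU shiftK_lapU
  lapU_imageShift Lhat_eq_perT)
open Summit.QuantumFields.BalabanUV.Beta.D1BFx.KGhostLeg (Cgh deltaCgh deltaCgh_pos decays_Cgh shiftK_Cgh isPeriodic₂_Cgh periodiseF_toF_Rgt_eq_submatrix
  periodiseF_toF_comp)

variable (s : ℕ) [NeZero s]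

/-! ## §1 Array linearity for a general fibre -/

section Linear

variable {D : ℕ} {F : Type*} {V W : MKer D F} {p q p' q' : Fin D → ℤ} {C δ C' δ' : ℝ}

/-- [folklore] Additivity of the fibred periodisation in matrix form. -/
theorem hat_add {K L : FibredPeriodisation.FKer D F F} (hK : ∀ a b x, Summable (Kfib K a b x)) (hL : ∀ a b x, Summable (Kfib L a b x)) :
    Matrix.of (periodiseF s (K + L)) = Matrix.of (periodiseF s K) + Matrix.of (periodiseF s L) := by
  ext i j
  exact periodiseF_add hK hL i j

omit [NeZero s] in
/-- [folklore] `toF` is additive. -/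
theorem toF_add (V W : MKer D F) : toF (V + W) = toF V + toF W := rfl

/-- [folklore] **`(arr (V + W))^ = (arr V)^ + (arr W)^`** for bi-localised `V`, `W`. -/
theorem hat_arr_add (hV : BiLoc V p q C δ) (hδ : 0 < δ) (hW : BiLoc W p' q' C' δ') (hδ' : 0 < δ') :
    Matrix.of (periodiseF s (toF (arr s (V + W))))
      = Matrix.of (periodiseF s (toF (arr s V))) + Matrix.of (periodiseF s (toF (arr s W))) := by
  have e : arr s (V + W) = arr s V + arr s W := by
    funext x y a b
    exact (summable_arr_term hV hδ s x y a b).tsum_add (summable_arr_term hW hδ' s x y a b)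
  rw [e, toF_add, hat_add s (fun a b x => ((rowBound_arr hV hδ s a b) x).1.of_abs) (fun a b x => ((rowBound_arr hW hδ' s a b) x).1.of_abs)]

/-- [folklore] **`(arr (−V))^ = −(arr V)^`**. -/
theorem hat_arr_neg (V : MKer D F) : Matrix.of (periodiseF s (toF (arr s (-V)))) = -Matrix.of (periodiseF s (toF (arr s V))) := by
  ext ⟨x, a⟩ ⟨y, b⟩
  have e : arr s (-V) = -arr s V := by
    funext x' y' a' b'
    exact tsum_neg
  rw [Matrix.neg_apply, Matrix.of_apply, Matrix.of_apply, periodiseF_apply, periodiseF_apply, e]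
  exact tsum_neg

/-- [folklore] **`(arr (c•V))^ = c•(arr V)^`**. -/
theorem hat_arr_smul (c : ℝ) (V : MKer D F) :
    Matrix.of (periodiseF s (toF (arr s (c • V)))) = c • Matrix.of (periodiseF s (toF (arr s V))) := by
  ext ⟨x, a⟩ ⟨y, b⟩
  have e : arr s (c • V) = c • arr s V := by
    funext x' y' a' b'
    simp only [arr_apply, Pi.smul_apply, smul_eq_mul]
    exact tsum_mul_left
  rw [Matrix.smul_apply, Matrix.of_apply, Matrix.of_apply, periodiseF_apply, periodiseF_apply, e, smul_eq_mul]
  exact tsum_mul_left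

/-- [folklore] **`(arr (V − W))^ = (arr V)^ − (arr W)^`** for bi-localised `V`, `W`. -/
theorem hat_arr_sub (hV : BiLoc V p q C δ) (hδ : 0 < δ) (hW : BiLoc W p' q' C' δ') (hδ' : 0 < δ') :
    Matrix.of (periodiseF s (toF (arr s (V - W))))
      = Matrix.of (periodiseF s (toF (arr s V))) - Matrix.of (periodiseF s (toF (arr s W))) := by
  rw [sub_eq_add_neg, hat_arr_add s hV hδ (show BiLoc (-W) p' q' C' δ' from SecondOrderResponse.biLoc_neg hW) hδ', hat_arr_neg,
    ← sub_eq_add_neg]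

end Linear

/-! ## §2 The bond sandwich commutes with the array -/

section Sandwich

variable {Z : MKer 4 Unit} {p q : Fin 4 → ℤ} {C δ : ℝ}

/-- [folklore] **`dSw (arr s Z) = arr s (dSw Z)`**: the bond sandwich `d∘·∘dᵀ` (a finite combination of unit shifts) passes through the array. -/
theorem dSw_arr (hZ : BiLoc Z p q C δ) (hδ : 0 < δ) : dSw (arr s Z) = arr s (dSw Z) := by
  have hsum : ∀ x y : Fin 4 → ℤ, Summable fun t : Fin 4 → ℤ => Z (x + (s : ℤ) • t) (y + (s : ℤ) • t) () () := fun x y => by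
    simpa only [imageShift_eq_add_smul] using summable_arr_term hZ hδ s x y () ()
  funext x z α β
  simp only [dSw_apply, arr_apply, imageShift_eq_add_smul]
  have e1 : ∀ t : Fin 4 → ℤ, x + (s : ℤ) • t + unitVec α = x + unitVec α + (s : ℤ) • t := fun t => add_right_comm _ _ _
  have e2 : ∀ t : Fin 4 → ℤ, z + (s : ℤ) • t + unitVec β = z + unitVec β + (s : ℤ) • t := fun t => add_right_comm _ _ _
  simp only [e1, e2]
  rw [((hsum _ _).sub (hsum _ _)).sub (hsum _ _) |>.tsum_add (hsum _ _), ((hsum _ _).sub (hsum _ _)).tsum_sub (hsum _ _),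
    (hsum _ _).tsum_sub (hsum _ _)]

/-- [folklore] `perT` read through `periodise₂` (both unfold to the same image series). -/
theorem perT_eq_periodise₂ (K : MKer 4 Unit) : perT s K = Matrix.of (periodise₂ s (Kfib (toF K) () ())) := rfl

/-- [folklore] **`D̂ · perT (arr Z) · D̂ᵀ = (arr (dSw Z))^`** for a bi-localised site kernel `Z` (the array is jointly periodic with uniformly bounded rows,
so 3b-β FILE 2's sandwich letter applies; then §2's commutation). -/
theorem Dhat_mul_perT_arr_mul_Dhat_transpose (hZ : BiLoc Z p q C δ) (hδ : 0 < δ) :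
    Dhat 4 s * perT s (arr s Z) * (Dhat 4 s)ᵀ = Matrix.of (periodiseF s (toF (arr s (dSw Z)))) := by
  rw [perT_eq_periodise₂, Dhat_mul_Yhat_mul_Dhat_transpose s (arr s Z) (isPeriodic₂_arr s Z () ()) (rowBound_arr hZ hδ s () ()),
    dSw_arr s hZ hδ]

end Sandwich

/-! ## §3 The legs `Ĉ`, `1 − P̂`, `L̂Ĉ`, `ĈL̂` as torus matrices of `ℤ⁴` kernels -/

section Legs

variable (n : ℕ) [NeZero n] (a : ℝ)

/-- [our object] **THE COMMON LEG RATE** `dB n a := min 1 (deltaCgh n a)` (below both the Laplacian's rate `1` and `Cgh`'s rate). A definition. -/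
def dB : ℝ := min 1 (deltaCgh n a)

/-- [folklore] `0 < dB`. -/
theorem dB_pos (ha : 0 < a) : 0 < dB n a := lt_min one_pos (deltaCgh_pos n a ha)

omit [NeZero n] in
/-- [folklore] `dB ≤ 1`. -/
theorem dB_le_one : dB n a ≤ 1 := min_le_left _ _

omit [NeZero n] in
/-- [folklore] `dB ≤ deltaCgh`. -/
theorem dB_le_deltaCgh : dB n a ≤ deltaCgh n a := min_le_right _ _

/-- [folklore] **DECAY OF THE LEG `lapU ∘ Cgh`** at the rate `dB/2`. -/
theorem decays_lapU_Cgh (ha : 0 < a) : ∃ C : ℝ, Decays (comp lapU (Cgh n a)) C (dB n a / 2) := by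
  obtain ⟨C, hC⟩ := decays_Cgh n a ha
  exact ⟨_, decays_comp (decays_of_le decays_lapU (dB_le_one n a)) (decays_of_le hC (dB_le_deltaCgh n a)) (half_pos (dB_pos n a ha)).le
    (half_lt_self (dB_pos n a ha))⟩

/-- [folklore] **DECAY OF THE LEG `Cgh ∘ lapU`** at the rate `dB/2`. -/
theorem decays_Cgh_lapU (ha : 0 < a) : ∃ C : ℝ, Decays (comp (Cgh n a) lapU) C (dB n a / 2) := by
  obtain ⟨C, hC⟩ := decays_Cgh n a ha
  exact ⟨_, decays_comp (decays_of_le hC (dB_le_deltaCgh n a)) (decays_of_le decays_lapU (dB_le_one n a)) (half_pos (dB_pos n a ha)).le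
    (half_lt_self (dB_pos n a ha))⟩

/-- [folklore] `Cgh` is invariant under the translations `s·t` of any multiple `s` of `n`. -/
theorem shiftK_Cgh_mul (ha : 0 < a) (p : ℕ) (t : Fin 4 → ℤ) : shiftK (((n * p : ℕ) : ℤ) • t) (Cgh n a) = Cgh n a := by
  rw [Nat.cast_mul, mul_smul]
  exact shiftK_Cgh n a ha ((p : ℤ) • t)

/-- [folklore] `lapU ∘ Cgh` is invariant under the translations `(n·p)·t`. -/
theorem shiftK_lapU_Cgh (ha : 0 < a) (p : ℕ) (t : Fin 4 → ℤ) : shiftK (((n * p : ℕ) : ℤ) • t) (comp lapU (Cgh n a)) = comp lapU (Cgh n a) := by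
  rw [← comp_shiftK, shiftK_lapU, shiftK_Cgh_mul n a ha p t]

/-- [folklore] `Cgh ∘ lapU` is invariant under the translations `(n·p)·t`. -/
theorem shiftK_Cgh_lapU (ha : 0 < a) (p : ℕ) (t : Fin 4 → ℤ) : shiftK (((n * p : ℕ) : ℤ) • t) (comp (Cgh n a) lapU) = comp (Cgh n a) lapU := by
  rw [← comp_shiftK, shiftK_lapU, shiftK_Cgh_mul n a ha p t]

/-- [folklore] Joint `(n·p)`-periodicity of `lapU ∘ Cgh` (the `hAper` letter of the product rules). -/
theorem lapU_Cgh_imageShift (ha : 0 < a) (p : ℕ) (x y t : Fin 4 → ℤ) (u v : Unit) :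
    comp lapU (Cgh n a) (imageShift (n * p) x t) (imageShift (n * p) y t) u v = comp lapU (Cgh n a) x y u v :=
  periodic_of_shiftK (shiftK_lapU_Cgh n a ha p) x y t u v

/-- [folklore] Joint `(n·p)`-periodicity of `Cgh ∘ lapU`. -/
theorem Cgh_lapU_imageShift (ha : 0 < a) (p : ℕ) (x y t : Fin 4 → ℤ) (u v : Unit) :
    comp (Cgh n a) lapU (imageShift (n * p) x t) (imageShift (n * p) y t) u v = comp (Cgh n a) lapU x y u v :=
  periodic_of_shiftK (shiftK_Cgh_lapU n a ha p) x y t u v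

variable (m : ℕ) (p : ℕ) [NeZero p] {ρ : Type*} [Fintype ρ] [DecidableEq ρ]

/-- [folklore] **`1 − P̂ = perT (Rgt (m+1) a)`** on `Site 4 ((m+1)·p)` (`KGhostLeg.periodiseF_toF_Rgt_eq_submatrix`, re-indexed back). -/
theorem Rhat_eq_perT (ha : 0 < a) :
    (1 : Matrix (Site 4 ((m + 1) * p)) (Site 4 ((m + 1) * p)) ℝ) - Phat m a ((m + 1) * p) = perT ((m + 1) * p) (Rgt (m + 1) a) := by
  rw [perT, periodiseF_toF_Rgt_eq_submatrix (m + 1) a ha, Matrix.submatrix_submatrix]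
  rfl

/-- [folklore] **`L̂·Ĉ·L̂ = perT (Rgt (m+1) a)`** (3a `Lhat_Chat_Lhat` + `Rhat_eq_perT`). -/
theorem Lhat_Chat_Lhat_eq_perT (ha : 0 < a) {N : Matrix (Site 4 ((m + 1) * p)) ρ ℝ}
    (hN : ∀ lam : Site 4 ((m + 1) * p) → ℝ, Shat m ((m + 1) * p) *ᵥ lam = 0 ↔ ∃ c : ρ → ℝ, lam = N *ᵥ c)
    (hNinj : Function.Injective N.mulVec) :
    Lhat ((m + 1) * p) * Chat ((m + 1) * p) N * Lhat ((m + 1) * p) = perT ((m + 1) * p) (Rgt (m + 1) a) := by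
  rw [Lhat_Chat_Lhat m p ha hN hNinj, Rhat_eq_perT a m p ha]

/-- [folklore] **`L̂ · perT Cgh = perT (lapU ∘ Cgh)`** (two decaying jointly periodic legs; `KGhostLeg.periodiseF_toF_comp` re-indexed). -/
theorem Lhat_mul_perT_Cgh (ha : 0 < a) :
    Lhat ((m + 1) * p) * perT ((m + 1) * p) (Cgh (m + 1) a) = perT ((m + 1) * p) (comp lapU (Cgh (m + 1) a)) := by
  obtain ⟨C, hC⟩ := decays_Cgh (m + 1) a ha
  rw [Lhat_eq_perT, perT, perT, perT, submatrix_unit_mul,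
    ← periodiseF_toF_comp decays_lapU one_pos hC (deltaCgh_pos (m + 1) a ha) (isPeriodic₂_Cgh (m + 1) a ha ⟨p, rfl⟩)]

/-- [folklore] **`perT Cgh · L̂ = perT (Cgh ∘ lapU)`**. -/
theorem perT_Cgh_mul_Lhat (ha : 0 < a) :
    perT ((m + 1) * p) (Cgh (m + 1) a) * Lhat ((m + 1) * p) = perT ((m + 1) * p) (comp (Cgh (m + 1) a) lapU) := by
  obtain ⟨C, hC⟩ := decays_Cgh (m + 1) a ha
  rw [Lhat_eq_perT, perT, perT, perT, submatrix_unit_mul,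
    ← periodiseF_toF_comp hC (deltaCgh_pos (m + 1) a ha) decays_lapU one_pos (fun u v => isPeriodic₂_lapKer _)]

end Legs

end Summit.QuantumFields.BalabanUV.Beta.D1BFx.TorusBondArrays

end
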